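import Summits.ResolutionOfSingularities.ResolutionOfSingularities.Theorems.FrobeniusLadderFInjectiveMacaulayficationOmegaFloorFactorsThroughClassModel
import Summits.ResolutionOfSingularities.ResolutionOfSingularities.Theorems.FrobeniusLadderFInjectiveMacaulayficationPencilBlowupLocalCharts
import HarnessLib

/-!
# BED Ω, GLOBAL PATCH (g-b), F5 STRUCTURE: the CURE CENTRE `𝓚 = K′·𝒪_{S′}` — for ANY ideal `K′` downstairs, every blowing up of the floor `S′ = Bl_{L³ + (g)L²} X` along `K′·𝒪_{S′}` is
# (isomorphic over `S′` to) the affine blow-up `Bl_{(L³ + (g)L²)·K′} X`, which factors through the REFINED CLASS MODEL `X̃₂ = Bl_{L²K′} X` as a blowing up along `(L + (g))·𝒪_{X̃₂}`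
# (Stacks 080A read in both orders) — so «CURED» (FULL everywhere after blowing up `𝓚`) is a chart-by-chart statement on `X̃₂`, in the currency of ✓p709719 `PencilBlowupLocalCharts`
# (crux `FInjectiveMacaulayfication` stmt-ResolutionOfSingularities-15315, chain w45a; res-L1-w45a-plan-1 R23.23 (1) kernel file F5 «the cure centre 𝓚 on S′ (E-cosupported)»,
# `g13/GLOBAL-PATCH-PLAN.md` F5/F6; seat res-L1-w45a-stub-3 g14)

[OURS · L1 W4.5a] Support file (`--supports stmt-ResolutionOfSingularities-15315 --as helper`); theorems only; GENERIC (any commutative ring `R`, ideals `L, K′`, element `g`); no named fact;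
NOT a statement of any manuscript; nothing of the crux is proved and no census row is asserted (which `K′` cures the Ω₁ floor is the content of F5/F6: the monomial ideal of the global cure
fan Σ₂, kit j329694). AI-written (AI review is weaker than expert review).

* `ideal_floor_mul_eq` — `(L³ + (g)L²)·K′ = (L·L·K′)·(L + (g))`; ★ `exists_cure_fac_classModel` — `Bl_{I′K′} X → X̃₂ = Bl_{L L K′} X` is a blowing up along `(L + (g))~·𝒪_{X̃₂}`,
  cosupported over `V(L)` (the F4 (a) shape with the refined class model);
* ★ `exists_cure_fac_floor` — `Bl_{I′K′} X → S′ = Bl_{I′} X` is a blowing up along `𝓚 := K′~·𝒪_{S′}`, with `supp 𝓚 ⊆ π_{I′}⁻¹ V(K′)`;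
* ★★ `fullCl_of_isBlowup_cure` — if `Bl_{I′K′} X` is `FullCl p` at every stalk then EVERY blowing up of `S′` along `𝓚` is `FullCl p` at every stalk (uniqueness of blow-ups ✓ `IsBlowup.unique`
  + stalk transport); `cmCl_of_isBlowup_cure` — the same for the CM clause.
[cite: StacksProject, Tag 080A; GortzWedhorn2020, Prop. 13.92 and (13.19)]
-/

set_option linter.dupNamespace false

noncomputable section

open AlgebraicGeometry CategoryTheory Literature.AlgebraicGeometry.Resolution

namespace Summit.ResolutionOfSingularities.ResolutionOfSingularities.Theorems.FInjectiveMacaulayfication.OmegaCureCentreFactors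

open Summit.ResolutionOfSingularities.ResolutionOfSingularities.Theorems.FInjectiveMacaulayfication
open SliceableCentre OmegaFloorFactorsThroughClassModel

variable {R : Type} [CommRing R] (L K : Ideal R) (g : R)

/-- `(L³ + (g)L²)·K′ = (L·L·K′)·(L + (g))`. [plumbing] -/
theorem ideal_floor_mul_eq : (L ^ 3 + Ideal.span {g} * L ^ 2) * K = (L * L * K) * (L + Ideal.span {g}) := by
  rw [ideal_floor_eq_mul]; ring

/-- ★ **`Bl_{(L³ + (g)L²)K′} X` FACTORS THROUGH THE REFINED CLASS MODEL `X̃₂ = Bl_{L·L·K′} X` AS A BLOWING UP ALONG `(L + (g))·𝒪_{X̃₂}`, COSUPPORTED OVER `V(L)`** (080A read backwards, as in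
F4 (a) with `L·L` replaced by `L·L·K′`). [OURS · BED Ω (g-b) F5; cite: StacksProject, Tag 080A] -/
theorem exists_cure_fac_classModel :
    ∃ τ : affineBlowup ((L ^ 3 + Ideal.span {g} * L ^ 2) * K) ⟶ affineBlowup (L * L * K),
      IsBlowup τ ((affineBlowup.idealSheaf (L + Ideal.span {g})).comap (affineBlowup.π (L * L * K))) ∧
      τ ≫ affineBlowup.π (L * L * K) = affineBlowup.π ((L ^ 3 + Ideal.span {g} * L ^ 2) * K) ∧
      ((((affineBlowup.idealSheaf (L + Ideal.span {g})).comap (affineBlowup.π (L * L * K))).support : Set (affineBlowup (L * L * K))) ⊆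
        (affineBlowup.π (L * L * K)).base ⁻¹' (PrimeSpectrum.zeroLocus (L : Set R))) := by
  have hS := affineBlowup.isBlowup ((L ^ 3 + Ideal.span {g} * L ^ 2) * K)
  have hI : affineBlowup.idealSheaf ((L ^ 3 + Ideal.span {g} * L ^ 2) * K) = affineBlowup.idealSheaf (L * L * K) * affineBlowup.idealSheaf (L + Ideal.span {g}) := by
    rw [ideal_floor_mul_eq, affineBlowup.idealSheaf_mul]
  rw [hI] at hS
  obtain ⟨τ, hτ, hfac⟩ := hS.exists_fac_of_mul (affineBlowup.isBlowup (L * L * K))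
  refine ⟨τ, hτ, hfac, ?_⟩
  rw [Scheme.IdealSheafData.support_comap]
  intro x hx
  have hx' : (affineBlowup.π (L * L * K)).base x ∈ ((affineBlowup.idealSheaf (L + Ideal.span {g})).support : Set (Spec (.of R))) := hx
  rw [affineBlowup.support_idealSheaf] at hx'
  exact PrimeSpectrum.zeroLocus_anti_mono (show (L : Set R) ⊆ (L + Ideal.span {g} : Ideal R) from fun r hr => Ideal.mem_sup_left hr) hx'

/-- ★ **`Bl_{(L³ + (g)L²)K′} X` IS A BLOWING UP OF THE FLOOR `S′ = Bl_{L³ + (g)L²} X` ALONG `𝓚 := K′~·𝒪_{S′}`**, and `supp 𝓚` lies over `V(K′)` (080A in the other order). [OURS · BED Ω (g-b) F5;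
cite: StacksProject, Tag 080A] -/
theorem exists_cure_fac_floor :
    ∃ σ : affineBlowup ((L ^ 3 + Ideal.span {g} * L ^ 2) * K) ⟶ affineBlowup (L ^ 3 + Ideal.span {g} * L ^ 2),
      IsBlowup σ ((affineBlowup.idealSheaf K).comap (affineBlowup.π (L ^ 3 + Ideal.span {g} * L ^ 2))) ∧
      σ ≫ affineBlowup.π (L ^ 3 + Ideal.span {g} * L ^ 2) = affineBlowup.π ((L ^ 3 + Ideal.span {g} * L ^ 2) * K) ∧
      ((((affineBlowup.idealSheaf K).comap (affineBlowup.π (L ^ 3 + Ideal.span {g} * L ^ 2))).support : Set (affineBlowup (L ^ 3 + Ideal.span {g} * L ^ 2))) ⊆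
        (affineBlowup.π (L ^ 3 + Ideal.span {g} * L ^ 2)).base ⁻¹' (PrimeSpectrum.zeroLocus (K : Set R))) := by
  have hS := affineBlowup.isBlowup ((L ^ 3 + Ideal.span {g} * L ^ 2) * K)
  rw [affineBlowup.idealSheaf_mul] at hS
  obtain ⟨σ, hσ, hfac⟩ := hS.exists_fac_of_mul (affineBlowup.isBlowup (L ^ 3 + Ideal.span {g} * L ^ 2))
  refine ⟨σ, hσ, hfac, ?_⟩
  rw [Scheme.IdealSheafData.support_comap]
  intro x hx
  have hx' : (affineBlowup.π (L ^ 3 + Ideal.span {g} * L ^ 2)).base x ∈ ((affineBlowup.idealSheaf K).support : Set (Spec (.of R))) := hx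
  rwa [affineBlowup.support_idealSheaf] at hx'

/-- ★★ **«CURED» IS A STATEMENT ABOUT ONE AFFINE BLOW-UP.** If `Bl_{(L³ + (g)L²)K′} X` is `FullCl p` at every stalk, then EVERY blowing up `ρ : S″ → S′` of the floor along `𝓚 = K′~·𝒪_{S′}` is
`FullCl p` at every stalk (both are blowings up along `𝓚`; ✓ `IsBlowup.unique` and stalk transport along the isomorphism). [OURS · BED Ω (g-b) F5; cite: GortzWedhorn2020, (13.19)] -/
theorem fullCl_of_isBlowup_cure (p : ℕ) (hfull : ∀ y : ↥(affineBlowup ((L ^ 3 + Ideal.span {g} * L ^ 2) * K)), FullCl p ((affineBlowup ((L ^ 3 + Ideal.span {g} * L ^ 2) * K)).presheaf.stalk y))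
    {S'' : Scheme.{0}} (ρ : S'' ⟶ affineBlowup (L ^ 3 + Ideal.span {g} * L ^ 2))
    (hρ : IsBlowup ρ ((affineBlowup.idealSheaf K).comap (affineBlowup.π (L ^ 3 + Ideal.span {g} * L ^ 2)))) (s : S'') :
    FullCl p (S''.presheaf.stalk s) := by
  obtain ⟨σ, hσ, -, -⟩ := exists_cure_fac_floor L K g
  obtain ⟨e, -, -⟩ := hρ.unique hσ
  haveI : IsIso (e.hom.stalkMap s) := inferInstance
  exact PencilBlowupLocalCharts.fullCl_of_ringEquiv' p (asIso (e.hom.stalkMap s)).commRingCatIsoToRingEquiv (hfull (e.hom.base s))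

/-- The same for the CM clause. [OURS · BED Ω (g-b) F5] -/
theorem cmCl_of_isBlowup_cure (hcm : ∀ y : ↥(affineBlowup ((L ^ 3 + Ideal.span {g} * L ^ 2) * K)), CMCl ((affineBlowup ((L ^ 3 + Ideal.span {g} * L ^ 2) * K)).presheaf.stalk y))
    {S'' : Scheme.{0}} (ρ : S'' ⟶ affineBlowup (L ^ 3 + Ideal.span {g} * L ^ 2))
    (hρ : IsBlowup ρ ((affineBlowup.idealSheaf K).comap (affineBlowup.π (L ^ 3 + Ideal.span {g} * L ^ 2)))) (s : S'') :
    CMCl (S''.presheaf.stalk s) := by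
  obtain ⟨σ, hσ, -, -⟩ := exists_cure_fac_floor L K g
  obtain ⟨e, -, -⟩ := hρ.unique hσ
  haveI : IsIso (e.hom.stalkMap s) := inferInstance
  exact FiLocusOpenOfAffine.cmClause_of_ringEquiv (asIso (e.hom.stalkMap s)).commRingCatIsoToRingEquiv (hcm (e.hom.base s))

/-! ## The refined class model as `Bl_{K″} X` (any ideal `K″` making `L` invertible) -/

/-- ★ **`Bl_{(L³ + (g)L²)K″} X → Bl_{K″} X` IS A BLOWING UP ALONG `(L + (g))·𝒪` AS SOON AS `L·𝒪_{Bl_{K″} X}` IS INVERTIBLE** (e.g. `K″` monomial with normal fan refining `Σ(L)`): 080A read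
backwards with first factor `K″`, then the invertible factor `(L·𝒪)²` is discarded (✓ `PencilBlowupLocalCharts.isBlowup_of_mul_isEffectiveCartier_left` twice). This is the form in which the
1223-chart refined class model `X̃₂ = Bl_{K″} X` of the global cure fan Σ₂ enters F6. [OURS · BED Ω (g-b) F5/F6; cite: StacksProject, Tag 080A] -/
theorem exists_cure_fac_of_isEffectiveCartier
    (hL : IsEffectiveCartier ((affineBlowup.idealSheaf L).comap (affineBlowup.π K))) :
    ∃ τ : affineBlowup ((L ^ 3 + Ideal.span {g} * L ^ 2) * K) ⟶ affineBlowup K,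
      IsBlowup τ ((affineBlowup.idealSheaf (L + Ideal.span {g})).comap (affineBlowup.π K)) ∧
      τ ≫ affineBlowup.π K = affineBlowup.π ((L ^ 3 + Ideal.span {g} * L ^ 2) * K) := by
  have hS := affineBlowup.isBlowup ((L ^ 3 + Ideal.span {g} * L ^ 2) * K)
  have hI : affineBlowup.idealSheaf ((L ^ 3 + Ideal.span {g} * L ^ 2) * K) =
      affineBlowup.idealSheaf K * (affineBlowup.idealSheaf L * (affineBlowup.idealSheaf L * affineBlowup.idealSheaf (L + Ideal.span {g}))) := by
    rw [ideal_floor_eq_mul, ← affineBlowup.idealSheaf_mul, ← affineBlowup.idealSheaf_mul, ← affineBlowup.idealSheaf_mul]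
    congr 1; ring
  rw [hI] at hS
  obtain ⟨τ, hτ, hfac⟩ := hS.exists_fac_of_mul (affineBlowup.isBlowup K)
  refine ⟨τ, ?_, hfac⟩
  rw [comap_mul, comap_mul] at hτ
  exact PencilBlowupLocalCharts.isBlowup_of_mul_isEffectiveCartier_left (PencilBlowupLocalCharts.isBlowup_of_mul_isEffectiveCartier_left hτ hL) hL

end Summit.ResolutionOfSingularities.ResolutionOfSingularities.Theorems.FInjectiveMacaulayfication.OmegaCureCentreFactors

end
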